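import Summits.SmoothPoincare4.SmoothPoincare4.Theorems.EntropyRungBakryEmeryLogSobolevGaffneyCutoff
import HarnessLib

/-!
# Conservation of mass for the weighted heat flow on a complete manifold with first-order (Gaffney)
# cut-offs (support item `EntropyRung.BakryEmeryLogSobolev`, stmt-SmoothPoincare4-16587)

Setting: `M` modelled on `ℝⁿ` (Hausdorff, second countable, `T₃`, Borel — NOT compact), `g` Riemannian with
its Levi-Civita connection, `V` smooth with `e^{-V} ∈ L¹` (NO further assumption), `L = Δ_g − g⁻¹(dV, d·)`,
Gaffney cut-offs `η_k` (`0 ≤ η_k ≤ 1`, `η_k(x) = 1` for large `k`, `|∇η_k|² ≤ C₀/(k+1)²`).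

`gaffney_massConservation` — for `u` smooth on `M × O` (`O ⊇ [0, T]` open), `∂ₛu = Lu` on `[0, T]`, bounded
(`|u| ≤ B`) with bounded gradient (`|∇u|² ≤ C_G`) on `[0, T]`: `∫ u(s) e^{-V} = ∫ u(0) e^{-V}` for
`s ∈ [0, T]`. With `F_k(s) = ∫ u(s) η_k² e^{-V}`: `F_k' = ∫ (Lu) η_k² e^{-V} = −2∫ η_k g⁻¹(dη_k, du) e^{-V}`
(`integral_mul_cutoffSq_mul_weightedLaplacian` with `a = 1`), `|F_k'| ≤ 2 √C₀/(k+1) √C_G ∫e^{-V}`, so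
`|F_k(s) − F_k(0)| → 0`, while `F_k(s) → ∫ u(s) e^{-V}` (dominated convergence). No bound on `Lη_k` or on
`Lu` is used (compare the shrinker toolkit's `helper_massConservation`). Everything is proved; no definitions.

## References

* [BakryGentilLedoux2014] D. Bakry, I. Gentil, M. Ledoux (2014), Thm. 3.2.6 (p. 147, mass conservation)
  with §3.2 (pp. 141–147: cut-offs `ζ_k`, `Γ(ζ_k) ≤ 1/k`).
* [Grigoryan2009] A. Grigor'yan (2009), Thm. 11.8 (stochastic completeness under finite volume).
-/

noncomputable section

set_option linter.dupNamespace false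

open scoped Manifold ContDiff ENNReal NNReal Topology
open MeasureTheory Set Filter
open Literature.Geometry.Lorentzian Literature.Geometry.Riemannian

namespace Summit.SmoothPoincare4.SmoothPoincare4.Theorems.BakryEmeryComplete

open NoncompactShrinkerGapHeat NoncompactShrinkerGapHeat.CutoffToolkit

section Mass

variable {n : ℕ} {M : Type*} [TopologicalSpace M] [T2Space M] [SecondCountableTopology M]
  [ChartedSpace (EuclideanSpace ℝ (Fin n)) M] [IsManifold (𝓡 n) ∞ M] [T3Space M] [MeasurableSpace M]
  [BorelSpace M]
  {g : PseudoRiemannianMetric (𝓡 n) ∞ (EuclideanSpace ℝ (Fin n)) (TangentSpace (𝓡 n) : M → Type _)}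
  [g.HasLeviCivita]

/-- **Conservation of mass for bounded solutions with bounded gradient of the weighted heat flow on a
complete manifold of finite weighted volume, with Gaffney cut-offs** (see the module docstring).
[cite: BakryGentilLedoux2014, Thm. 3.2.6 (p. 147) with §3.2 (pp. 141–147)] [cite: Grigoryan2009, Thm. 11.8] -/
theorem gaffney_massConservation (hg : g.IsRiemannian) {V : M → ℝ} (hV : ContMDiff (𝓡 n) 𝓘(ℝ, ℝ) ∞ V)
    (hw : Integrable (fun y ↦ Real.exp (-V y)) g.riemVolume)
    {η : ℕ → M → ℝ} {C₀ : ℝ} (hηs : ∀ k, ContMDiff (𝓡 n) 𝓘(ℝ, ℝ) ∞ (η k))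
    (hηc : ∀ k, HasCompactSupport (η k)) (hη01 : ∀ k x, 0 ≤ η k x ∧ η k x ≤ 1)
    (hη1 : ∀ x, ∀ᶠ k in atTop, η k x = 1)
    (hηgrad : ∀ k x, g.gradSq (η k) x ≤ C₀ / ((k : ℝ) + 1) ^ 2)
    {T : ℝ} {O : Set ℝ} {u : ℝ → M → ℝ} (hO : IsOpen O) (hTO : Icc 0 T ⊆ O)
    (hu : ContMDiffOn ((𝓡 n).prod 𝓘(ℝ, ℝ)) 𝓘(ℝ, ℝ) ∞ (fun p : M × ℝ ↦ u p.2 p.1) (univ ×ˢ O))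
    (heq : ∀ s ∈ Icc 0 T, ∀ x, deriv (fun r ↦ u r x) s = g.dalembertian (u s) x
      - g.innerDual x (mvfderiv (𝓡 n) V x).toLinearMap (mvfderiv (𝓡 n) (u s) x).toLinearMap)
    {B CG : ℝ} (hB : ∀ s ∈ Icc 0 T, ∀ x, |u s x| ≤ B) (hG : ∀ s ∈ Icc 0 T, ∀ x, g.gradSq (u s) x ≤ CG)
    {s : ℝ} (hs : s ∈ Icc 0 T) :
    ∫ x, u s x * Real.exp (-V x) ∂g.riemVolume = ∫ x, u 0 x * Real.exp (-V x) ∂g.riemVolume := by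
  haveI := CarrilloNi2009_shrinkerLSI.isFiniteMeasureOnCompacts_riemVolume hg
  set μ : Measure M := g.riemVolume with hμ
  have h0T : (0 : ℝ) ≤ T := hs.1.trans hs.2
  have h0 : (0 : ℝ) ∈ Icc 0 T := ⟨le_rfl, h0T⟩
  have hec : Continuous fun x ↦ Real.exp (-V x) := Real.continuous_exp.comp hV.continuous.neg
  have hslice : ∀ r ∈ O, ContMDiff (𝓡 n) 𝓘(ℝ, ℝ) ∞ (u r) := fun r hr ↦ contMDiff_slice_of_contMDiffOn hu hr
  have hρc : ContinuousOn (fun p : M × ℝ ↦ u p.2 p.1) (univ ×ˢ O) := hu.continuousOn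
  have hρ'c : ContinuousOn (fun p : M × ℝ ↦ deriv (fun r ↦ u r p.1) p.2) (univ ×ˢ O) :=
    continuousOn_deriv_time hO hu
  have hCG0 : ∀ x : M, 0 ≤ CG := fun x ↦ (g.gradSq_nonneg hg _ x).trans (hG 0 h0 x)
  have hC₀ : ∀ x : M, 0 ≤ C₀ := fun x ↦ by
    have h1 := hηgrad 0 x
    have h2 : 0 ≤ g.gradSq (η 0) x := g.gradSq_nonneg hg _ _
    rcases div_nonneg_iff.1 (h2.trans h1) with h | h
    · exact h.1
    · exact absurd h.2 (not_le.mpr (by positivity))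
  set W₀ : ℝ := ∫ x, Real.exp (-V x) ∂μ with hW₀
  have hW₀0 : 0 ≤ W₀ := integral_nonneg fun x ↦ (Real.exp_pos _).le
  -- the cut-off masses and the bound on their variation
  have hkey : ∀ k, |(∫ x, u s x * (η k x ^ 2 * Real.exp (-V x)) ∂μ)
      - ∫ x, u 0 x * (η k x ^ 2 * Real.exp (-V x)) ∂μ| ≤
      (2 * (Real.sqrt C₀ / ((k : ℝ) + 1)) * Real.sqrt CG * W₀) * s := by
    intro k
    have hη2c : HasCompactSupport (fun x ↦ η k x ^ 2) := by
      rw [show (fun x ↦ η k x ^ 2) = fun x ↦ η k x * η k x from funext fun x ↦ sq (η k x)]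
      exact (hηc k).mul_right
    have hwk : Continuous fun x ↦ η k x ^ 2 * Real.exp (-V x) := ((hηs k).continuous.pow 2).mul hec
    have hwkc : HasCompactSupport fun x ↦ η k x ^ 2 * Real.exp (-V x) := hη2c.mul_right
    set Fk : ℝ → ℝ := fun r ↦ ∫ x, u r x * (η k x ^ 2 * Real.exp (-V x)) ∂μ with hFk
    set Dk : ℝ → ℝ := fun r ↦ ∫ x, deriv (fun r' ↦ u r' x) r * (η k x ^ 2 * Real.exp (-V x)) ∂μ with hDk
    have hderiv : ∀ r ∈ O, HasDerivAt Fk (Dk r) r := fun r hr ↦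
      hasDerivAt_integral_mul_of_hasCompactSupport μ hwk hwkc hO hρc hρ'c (fun r hr x ↦ hasDerivAt_time hO hu x hr) hr
    -- on `[0, T]` the derivative is `−2 ∫ η g(dη, du) e^{-V}`, bounded
    have hbound : ∀ r ∈ Ico (0 : ℝ) T, ‖Dk r‖ ≤ 2 * (Real.sqrt C₀ / ((k : ℝ) + 1)) * Real.sqrt CG * W₀ := by
      intro r hr
      have hr' : r ∈ Icc 0 T := Ico_subset_Icc_self hr
      have hus := hslice r (hTO hr')
      have hid := integral_mul_cutoffSq_mul_weightedLaplacian hg (a := fun _ : M ↦ (1 : ℝ)) contMDiff_const hus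
        (hηs k) (hηc k) hV
      have e1 : Dk r = ∫ x, (fun _ : M ↦ (1 : ℝ)) x * η k x ^ 2 * (g.dalembertian (u r) x
          - g.innerDual x (mvfderiv (𝓡 n) V x).toLinearMap (mvfderiv (𝓡 n) (u r) x).toLinearMap) *
            Real.exp (-V x) ∂μ := by
        refine integral_congr_ae (Eventually.of_forall fun x ↦ ?_)
        dsimp only
        rw [heq r hr' x]
        ring
      have e2 : ∫ x, η k x ^ 2 * g.innerDual x (mvfderiv (𝓡 n) (fun _ : M ↦ (1 : ℝ)) x).toLinearMap
          (mvfderiv (𝓡 n) (u r) x).toLinearMap * Real.exp (-V x) ∂μ = 0 := by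
        refine integral_eq_zero_of_ae (Eventually.of_forall fun x ↦ ?_)
        simp [mvfderiv_const, PseudoRiemannianMetric.innerDual]
      have h1le : (1 : ℕ∞ω) ≤ (∞ : ℕ∞ω) := WithTop.coe_le_coe.mpr le_top
      have hIc : Continuous fun x ↦ g.innerDual x (mvfderiv (𝓡 n) (η k) x).toLinearMap
          (mvfderiv (𝓡 n) (u r) x).toLinearMap := continuous_innerDual_mvfderiv g ((hηs k).of_le h1le) (hus.of_le h1le)
      have iX : Integrable (fun x ↦ (fun _ : M ↦ (1 : ℝ)) x * η k x * g.innerDual x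
          (mvfderiv (𝓡 n) (η k) x).toLinearMap (mvfderiv (𝓡 n) (u r) x).toLinearMap * Real.exp (-V x)) μ :=
        integrable_of_continuous_of_hasCompactSupport' hg (((continuous_const.mul (hηs k).continuous).mul hIc).mul hec)
          ((((hηc k).mul_left).mul_right).mul_right)
      have hpt : ∀ x, |(fun _ : M ↦ (1 : ℝ)) x * η k x * g.innerDual x
          (mvfderiv (𝓡 n) (η k) x).toLinearMap (mvfderiv (𝓡 n) (u r) x).toLinearMap * Real.exp (-V x)| ≤
          (Real.sqrt C₀ / ((k : ℝ) + 1)) * Real.sqrt CG * Real.exp (-V x) := by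
        intro x
        have hI := abs_innerDual_le_sqrt_gradSq_mul hg (η k) (u r) x
        have h2 : Real.sqrt (g.gradSq (η k) x) ≤ Real.sqrt C₀ / ((k : ℝ) + 1) := by
          have h := Real.sqrt_le_sqrt (hηgrad k x)
          rwa [Real.sqrt_div (hC₀ x), Real.sqrt_sq (by positivity)] at h
        have h3 : Real.sqrt (g.gradSq (u r) x) ≤ Real.sqrt CG := Real.sqrt_le_sqrt (hG r hr' x)
        have hηabs : |η k x| ≤ 1 := abs_le.2 ⟨by linarith [(hη01 k x).1], (hη01 k x).2⟩
        rw [abs_mul, abs_mul, abs_mul, abs_of_nonneg (Real.exp_pos _).le]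
        dsimp only
        rw [abs_one, one_mul]
        calc |η k x| * |g.innerDual x (mvfderiv (𝓡 n) (η k) x).toLinearMap
              (mvfderiv (𝓡 n) (u r) x).toLinearMap| * Real.exp (-V x)
            ≤ 1 * (Real.sqrt C₀ / ((k : ℝ) + 1) * Real.sqrt CG) * Real.exp (-V x) := by
              refine mul_le_mul_of_nonneg_right ?_ (Real.exp_pos _).le
              exact mul_le_mul hηabs (hI.trans (mul_le_mul h2 h3 (Real.sqrt_nonneg _) (by positivity)))
                (abs_nonneg _) zero_le_one
          _ = Real.sqrt C₀ / ((k : ℝ) + 1) * Real.sqrt CG * Real.exp (-V x) := by ring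
      rw [e1, hid, e2, neg_zero, zero_sub, norm_neg, norm_mul, Real.norm_eq_abs, Real.norm_eq_abs,
        show |(2 : ℝ)| = 2 by norm_num]
      calc 2 * |∫ x, (fun _ : M ↦ (1 : ℝ)) x * η k x * g.innerDual x (mvfderiv (𝓡 n) (η k) x).toLinearMap
            (mvfderiv (𝓡 n) (u r) x).toLinearMap * Real.exp (-V x) ∂μ|
          ≤ 2 * ∫ x, (Real.sqrt C₀ / ((k : ℝ) + 1)) * Real.sqrt CG * Real.exp (-V x) ∂μ := by
            refine mul_le_mul_of_nonneg_left ?_ (by norm_num)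
            exact abs_integral_le_integral_abs.trans (integral_mono iX.abs (hw.const_mul _) hpt)
        _ = 2 * (Real.sqrt C₀ / ((k : ℝ) + 1)) * Real.sqrt CG * W₀ := by rw [integral_const_mul]; ring
    have hmv := norm_image_sub_le_of_norm_deriv_le_segment' (f := Fk)
      (fun r hr ↦ (hderiv r (hTO hr)).hasDerivWithinAt) hbound s hs
    rw [sub_zero, Real.norm_eq_abs] at hmv
    exact hmv
  -- `k → ∞`
  have hsq1 : ∀ k x, η k x ^ 2 ≤ 1 := fun k x ↦ pow_le_one₀ (hη01 k x).1 (hη01 k x).2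
  have hlimF : ∀ r ∈ Icc 0 T, Tendsto (fun k ↦ ∫ x, u r x * (η k x ^ 2 * Real.exp (-V x)) ∂μ) atTop
      (𝓝 (∫ x, u r x * Real.exp (-V x) ∂μ)) := by
    intro r hr
    have hur := hslice r (hTO hr)
    refine tendsto_integral_of_dominated_convergence (fun x ↦ B * Real.exp (-V x))
      (fun k ↦ ((hur.continuous.mul (((hηs k).continuous.pow 2).mul hec)).aestronglyMeasurable))
      (hw.const_mul B) (fun k ↦ Eventually.of_forall fun x ↦ ?_) (Eventually.of_forall fun x ↦ ?_)
    · rw [Real.norm_eq_abs, abs_mul, abs_mul, abs_of_nonneg (sq_nonneg (η k x)), abs_of_nonneg (Real.exp_pos _).le]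
      calc |u r x| * (η k x ^ 2 * Real.exp (-V x)) ≤ B * (1 * Real.exp (-V x)) :=
            mul_le_mul (hB r hr x) (mul_le_mul_of_nonneg_right (hsq1 k x) (Real.exp_pos _).le)
              (mul_nonneg (sq_nonneg _) (Real.exp_pos _).le) ((abs_nonneg _).trans (hB r hr x))
        _ = B * Real.exp (-V x) := by ring
    · have h := (tendsto_cutoff_of_eventually_eq hη1 x).pow 2
      have h2 : Tendsto (fun k ↦ u r x * (η k x ^ 2 * Real.exp (-V x))) atTop
          (𝓝 (u r x * (1 ^ 2 * Real.exp (-V x)))) := (h.mul_const _).const_mul _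
      simpa using h2
  have hlimε : Tendsto (fun k : ℕ ↦ (2 * (Real.sqrt C₀ / ((k : ℝ) + 1)) * Real.sqrt CG * W₀) * s) atTop (𝓝 0) := by
    have h1 : Tendsto (fun k : ℕ ↦ (k : ℝ) + 1) atTop atTop :=
      tendsto_atTop_add_const_right _ 1 (tendsto_natCast_atTop_atTop (R := ℝ))
    have hδ : Tendsto (fun k : ℕ ↦ Real.sqrt C₀ / ((k : ℝ) + 1)) atTop (𝓝 0) := tendsto_const_nhds.div_atTop h1
    simpa using (((hδ.const_mul 2).mul_const (Real.sqrt CG)).mul_const W₀).mul_const s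
  have hdiff : Tendsto (fun k ↦ (∫ x, u s x * (η k x ^ 2 * Real.exp (-V x)) ∂μ)
      - ∫ x, u 0 x * (η k x ^ 2 * Real.exp (-V x)) ∂μ) atTop
      (𝓝 ((∫ x, u s x * Real.exp (-V x) ∂μ) - ∫ x, u 0 x * Real.exp (-V x) ∂μ)) :=
    (hlimF s hs).sub (hlimF 0 h0)
  have hzero : (∫ x, u s x * Real.exp (-V x) ∂μ) - ∫ x, u 0 x * Real.exp (-V x) ∂μ = 0 := by
    have habs := (continuous_abs.tendsto _).comp hdiff
    have hle : ∀ k, |(∫ x, u s x * (η k x ^ 2 * Real.exp (-V x)) ∂μ)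
        - ∫ x, u 0 x * (η k x ^ 2 * Real.exp (-V x)) ∂μ| ≤ (2 * (Real.sqrt C₀ / ((k : ℝ) + 1)) * Real.sqrt CG * W₀) * s :=
      hkey
    have h := le_of_tendsto_of_tendsto' habs hlimε hle
    exact abs_nonpos_iff.1 h
  linarith

end Mass

end Summit.SmoothPoincare4.SmoothPoincare4.Theorems.BakryEmeryComplete

end
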